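import Summits.AtomisticToContinuum.BoseEinsteinCondensation.Theses.BECCutLineWeakDisorder
import Summits.AtomisticToContinuum.BoseEinsteinCondensation.Theses.BECClassicalWindow
import Literature.MathematicalPhysics.QuantumManyBody.GroundState
import Summits.AtomisticToContinuum.BoseEinsteinCondensation.Theorems.BECCutLineWeakDisorderGroundStateRigidityHardCoreOfConnected
import Summits.AtomisticToContinuum.BoseEinsteinCondensation.Theorems.BECCutLineWeakDisorderGroundStateRigidityStubPosOfConnected
import Summits.AtomisticToContinuum.BoseEinsteinCondensation.Theorems.BECCutLineWeakDisorderGroundStateRigidityLocBdd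
import Summits.AtomisticToContinuum.BoseEinsteinCondensation.Theorems.GroundStateRigidity.Negative.LoadBearingHypotheses
import Mathlib.Analysis.Convex.PathConnected
import HarnessLib.Audit

/-!
# Line `pinning-exclusion` — ALTERNATIVE skeleton for crux `BECCutLineWeakDisorder.GroundStateRigidity`
(item stmt-AtomisticToContinuum-9072, shared by 8 routes; strategist
planner-cstrat-stmt-AtomisticToContinuum-9072-s1-0, 2026-08-17; registered with `--alt`, it does NOT touch the
live line `Sketch` (skeleton v8, sha d694a874f8f0) or its stubs)

Crux (fixed, by name): `GroundStateRigidity` — for every repulsive finite-range `v` there is `ρ₀ > 0` such that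
for `0 < ρ < ρ₀`, all large `N` and every `η > 0` some `δ > 0` makes any two `δ`-near-minimisers of the
Dirichlet energy in the box of side `(N/ρ)^{1/3}` `η`-close in `L²` up to a constant phase.

## Idea: energy ordering instead of connectivity (dodges the STUCK goal `stub_cubeConnected`)

Line `Sketch` reduced the crux, for the flagship hard-core class `v = ⊤·1_{[0,b]} + (tail ≤ C)`, to
PATH-CONNECTEDNESS of the dilute labelled hard-sphere configuration space in the cube (its Stub 21
`stub_cubeConnected`; Baryshnikov–Bubenik–Kahle's open question, IMRN 2014 §6; flagged "not safely true" by
lead c4: sparse wall-braced vault foams are a credible obstruction, numerics j020405/j020446/j021371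
inconclusive). Uniqueness of the ground state does NOT need connectivity: it needs only that every
configuration-space component OTHER than the principal (dilute, "parked") one is ENERGETICALLY EXCLUDED. This
line types that weaker route:

* `stub_parking` (geometry, provable, L): well-separated configurations (all pair distances `> κ b`) exist and
  are pairwise joined through the free region `F_b` at `N b³ ≤ c₁ L³` ("lots of room": sequential parking on a
  coarse grid + adjacent transpositions realise every relabelling).
* `stub_pinnedOrParked` (geometry, the RESEARCH KERNEL, strictly weaker than `CubeConnected`): at
  `N b³ ≤ c₂ L³` every free configuration is either joined to a well-separated one, or some ONE label stays
  in a ball of MESOSCOPIC radius `r`, `N r³ ≤ θ L³` (a fraction of the mean spacing, `≫ b` at low density),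
  throughout its path component (a wall-braced jammed backbone pins its spheres within its margin `≤ b`;
  `CubeConnected ⇒` the first alternative always). False only for a LOOSE trap ("treadmill": a non-principal
  component in which every sphere roams a fraction of the mean spacing), for which no mechanism is known; true
  for every catalogued obstruction to `CubeConnected` (vault foams, notched rings: depth ∝ margin ≤ b).
* `stub_restrictToInvariantPiece` (analysis, M–L): RESTRICTION PRINCIPLE for the hard-core class — a closed-form
  ground state that does not vanish a.e. on a permutation-invariant union `Q` of components of `F_b` yields a
  ground state a.e. supported in `Q` (finite-energy trial states vanish to first order on the contact set, so
  `Φₙ·1_Q` is again an admissible trial state; energies and norms split; renormalise; `IsGroundState.of_tendstoL2`).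
* `stub_releaseReinsert` (analysis, the second kernel, L–XL, provable): NO ground state is a.e. supported in a
  permutation-invariant union `Q` of components each of which pins a label within radius `r`, `N r³ ≤ θ₀ L³`
  (`θ₀` absolute), once `N R³ ≤ c₃ L³` (`R ≥ b` a range of `v`): RELEASE the pinned particle (its kinetic
  energy is `≥ (π/2r)²` by the Dirichlet–Poincaré bound on a slab of width `2r`; the marginal amplitude
  `(∫|Ψ|² dx_i)^{1/2}` of the other `N−1` particles has no larger energy, by convexity) and RE-INSERT it in the
  `y`-normalised smooth superposition over the empty cells of a grid of `16N` cells of side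
  `ℓ = L/(16N)^{1/3} ≥ 4R` (pigeonhole: `≥ 8N` cells are empty at every configuration; the cross term
  vanishes identically because `∫F² dy ≡ 1`; the gradient of the cell weights is diluted by the `≥ 8N` empty
  cells, so the total cost is `≤ C/ℓ²` with an absolute `C`), then SYMMETRISE by the `ℓ²`-trick
  `Θ = (ε² + Σ_σ (Θ_C ∘ σ)²)^{1/2} − ε` (a `C¹` Bose-symmetric Dirichlet function with
  `∫|∇Θ|² ≤ Σ_σ ∫|∇(Θ_C∘σ)|²`, `VΘ² ≤ Σ_σ V(Θ_C∘σ)²`, `‖Θ‖² → Σ_σ ‖Θ_C∘σ‖²`), which replaces the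
  "Bose = Boltzmann" identity the Boltzmann-frame version of this argument would need: the Rayleigh quotient
  drops strictly below `E₀` — contradiction.
* `stub_uniquenessKernelZoo` (verbatim the live line's Stub 22, shared open kernel: walls that are not a plain
  hard core + bounded tail).

## Composition (sorry-free): `GroundStateRigidity_of`

Essentially locally bounded `v` (class (a), incl. bounded and soft cores): landed
`hasUniqueGroundState_of_essLocBdd` (p122811) with `E₀ < ⊤` eventually (`stub_finiteEnergyLowDensity`). Essential
hard-core class: carrier `P` = the PRINCIPAL REGION (free configurations joined to a well-separated one; open,
permutation invariant, a single path class by `stub_parking`); its complement `Q` in `F_b` is open, invariant,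
closed under paths and pinned (`stub_pinnedOrParked`), so no ground state charges it
(`stub_restrictToInvariantPiece` + `stub_releaseReinsert`); with the landed `stub_vanishOffFree` every ground
state vanishes a.e. off `P`; a.e. positivity on `P` is the LANDED component-wise Perron–Frobenius theorem
`stub_posOfConnected` (p126419, fed with `stub_chainedTube stub_localTubeCore`, `stub_polygonalChain` and
`groundStateEnergy_trunc_iSup_hardCore`), and uniqueness is the landed lattice argument `stub_uniqueOfPosOn`.
The zoo by Stub 22. Rigidity from uniqueness by the landed `stub_rigidityOfUnique stub_compactness`.

Disproof obligations honoured (`Cruxes/GroundStateRigidity/Disproof.lean`, `Theorems/…/Negative/*`):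
`groundStateRigidity_false_without_finiteRange` — finite range is used in `stub_releaseReinsert` (insertion
beyond the range `R`) and in `stub_finiteEnergyLowDensity`; `groundStateRigidity_false_at_all_densities` and
`Negative/TwoHardSpheres` (degenerate ground state of two unit hard spheres at `1/3 < L² < 1/2`) — low density
enters through `ρ b³ ≤ min(c₁, c₂)` and `ρ R³ ≤ c₃`; no stub is an instance of a landed Negative lemma (each
geometric stub carries the dilution hypothesis `N b³ ≤ c L³`).
-/

noncomputable section

open MeasureTheory Filter Metric
open scoped ENNReal NNReal ComplexConjugate Topology

namespace Summit.AtomisticToContinuum.BoseEinsteinCondensation.Cruxes.GroundStateRigidity.PinningExclusion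

open Literature.MathematicalPhysics.QuantumManyBody.BoseGas
open Summit.AtomisticToContinuum.BoseEinsteinCondensation.Theses.BECCutLineWeakDisorder
open Summit.AtomisticToContinuum.BoseEinsteinCondensation.Theorems.GroundStateRigidity

/-! ## Registered stubs (`sorry` only here) -/

/-- **Stub P1 — parking (geometry; "lots of room").** There are an absolute separation factor `κ > 1` and a
dilution constant `c₁ > 0` such that for `N b³ ≤ c₁ L³` (i) the cube `(0,L)³` holds `N` points with all pair
distances `> κ b`, and (ii) any two such WELL-SEPARATED labelled configurations are joined by a continuous path
of configurations of the open cube with all pair distances `> b`. (Sequential parking onto a grid of spacing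
`s ≫ κ b` avoiding the start positions — each obstacle blocks at most one site — through the vacant region of
pairwise `≥ 2b`-separated obstacles, whose only bounded pockets are corner pockets of diameter `< 1.3 b`; then
adjacent transpositions on the grid, which generate `S_N`.) Strictly weaker than `CubeConnected` (endpoints are
well separated). [cite: BaryshnikovBubenikKahle2013, Thm 5.1] -/
theorem stub_parking :
    ∃ κ : ℝ, 1 < κ ∧ ∃ c₁ : ℝ, 0 < c₁ ∧ ∀ (N : ℕ) (L b : ℝ), 0 < L → 0 < b →
      (N : ℝ) * b ^ 3 ≤ c₁ * L ^ 3 →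
      (∃ W : Config N, W ∈ boxN N L ∧ ∀ i j : Fin N, i ≠ j → κ * b < dist (W i) (W j)) ∧
      ∀ W₁ ∈ {Z : Config N | Z ∈ boxN N L ∧ ∀ i j : Fin N, i ≠ j → κ * b < dist (Z i) (Z j)},
      ∀ W₂ ∈ {Z : Config N | Z ∈ boxN N L ∧ ∀ i j : Fin N, i ≠ j → κ * b < dist (Z i) (Z j)},
        JoinedIn {Z : Config N | Z ∈ boxN N L ∧ ∀ i j : Fin N, i ≠ j → b < dist (Z i) (Z j)} W₁ W₂ := by
  sorry

/-- **Stub P2 — PINNED OR PARKED (geometry; the research kernel of this line, strictly weaker than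
`CubeConnected`).** For every separation factor `κ > 1` and every pinning fraction `θ > 0` there is `c₂ > 0`
such that for `N b³ ≤ c₂ L³` every configuration `X` of the free region `F_b(N,L)` is EITHER joined in `F_b` to a
well-separated configuration (all pair distances `> κ b`), OR has a label `i` that stays in one ball of
MESOSCOPIC radius `r`, `N r³ ≤ θ L³` (a `θ^{1/3}` fraction of the mean spacing — at low density this is `≫ b`),
along every path in `F_b` starting at `X`. (A pinned sphere of a wall-braced jammed backbone: by the Connelly
struts principle a non-principal component carries, at the top of the min-distance function, a positively
self-stressed strut framework touching all six faces; every catalogued such framework — vault foams, notched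
rings — is TIGHT, depth ∝ margin `≤ b ≪ r`; `CubeConnected ⇒` the first alternative always.) Fails only for a
LOOSE trap (a non-principal component in which EVERY sphere roams a positive fraction of the mean spacing); no
mechanism known (cf. `Disproof.lean`, verdict: "a refutation would need a NEW kind of component (loose yet
caged)"). [cite: BaryshnikovBubenikKahle2013, §6; Kahle2012] -/
theorem stub_pinnedOrParked :
    ∀ κ : ℝ, 1 < κ → ∀ θ : ℝ, 0 < θ → ∃ c₂ : ℝ, 0 < c₂ ∧ ∀ (N : ℕ) (L b : ℝ), 0 < L → 0 < b →
      (N : ℝ) * b ^ 3 ≤ c₂ * L ^ 3 →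
      ∀ X ∈ {Z : Config N | Z ∈ boxN N L ∧ ∀ i j : Fin N, i ≠ j → b < dist (Z i) (Z j)},
        (∃ W ∈ {Z : Config N | Z ∈ boxN N L ∧ ∀ i j : Fin N, i ≠ j → κ * b < dist (Z i) (Z j)},
          JoinedIn {Z : Config N | Z ∈ boxN N L ∧ ∀ i j : Fin N, i ≠ j → b < dist (Z i) (Z j)} X W) ∨
        (∃ (i : Fin N) (p : Space) (r : ℝ), (N : ℝ) * r ^ 3 ≤ θ * L ^ 3 ∧ ∀ Y : Config N,
          JoinedIn {Z : Config N | Z ∈ boxN N L ∧ ∀ i j : Fin N, i ≠ j → b < dist (Z i) (Z j)} X Y →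
            dist (Y i) p ≤ r) := by
  sorry

/-- **Stub P3 — restriction principle for the hard-core class (analysis).** Let `v = ⊤` on `[0,b]` (`b > 0`)
and let `Q ⊆ F_b(N,L)` be open, permutation invariant and closed under paths in the free region (a union of
path components together with their permutation images). If a closed-form ground state `Ψ` does NOT vanish
a.e. on `Q`, then some closed-form ground state is a.e. supported in `Q`. (Finite-energy `C¹` trial states
vanish together with their derivative on the contact set `{∃ i ≠ j, |xᵢ−xⱼ| ≤ b}` and off the open box, so for an
approximating sequence `Φₙ → Ψ` the restrictions `Φₙ·1_Q` are again Bose-symmetric `C¹` Dirichlet functions;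
energies and norms split over `Q ⊔ Qᶜ`; both normalised pieces have energy `≥ E₀`, hence the `Q`-piece has
energy `→ E₀`; `IsGroundState.of_tendstoL2`.) [cite: Kato1966, VI §1.3 Thm 1.16; ReedSimonIV1978, Thm XIII.48] -/
theorem stub_restrictToInvariantPiece :
    ∀ (N : ℕ) (v : ℝ → ℝ≥0∞) (L b : ℝ), 0 < L → 0 < b → Measurable v →
      (∀ s : ℝ, s ∈ Set.Icc 0 b → v s = ⊤) →
      ∀ Q : Set (Config N), IsOpen Q →
        Q ⊆ {Z : Config N | Z ∈ boxN N L ∧ ∀ i j : Fin N, i ≠ j → b < dist (Z i) (Z j)} →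
        (∀ X ∈ Q, ∀ Y : Config N,
          JoinedIn {Z : Config N | Z ∈ boxN N L ∧ ∀ i j : Fin N, i ≠ j → b < dist (Z i) (Z j)} X Y →
            Y ∈ Q) →
        (∀ (σ : Equiv.Perm (Fin N)) (X : Config N), X ∈ Q → X ∘ σ ∈ Q) →
        ∀ Ψ : Config N → ℂ, IsGroundState v L Ψ →
          (¬ ∀ᵐ X : Config N, X ∈ Q → Ψ X = 0) →
          ∃ Φ : Config N → ℂ, IsGroundState v L Φ ∧ ∀ᵐ X : Config N, X ∉ Q → Φ X = 0 := by
  sorry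

/-- **Stub P4 — release and re-insert: mesoscopically pinned components carry no ground state (analysis;
Bose frame).** There are absolute `θ₀ > 0` and `c₃ > 0` such that for the hard-core class (`v = ⊤` on `[0,b]`,
`v ≤ C` on `(b,∞)`, `v = 0` beyond a range `R ≥ b`), `N ≥ 1`, `L > 0` and `N R³ ≤ c₃ L³`, NO closed-form ground
state is a.e. supported in an open, permutation-invariant, path-closed `Q ⊆ F_b(N,L)` each of whose points has
a label pinned, along its path component, in a ball of radius `r` with `N r³ ≤ θ₀ L³`. (Release: the pinned
particle's kinetic energy is `≥ (π/2r)²`, Dirichlet–Poincaré on a slab of width `2r`, while the regularised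
marginal amplitude `(ε² + ∫|Ψ|² dxᵢ)^{1/2} − ε` of the other particles has no larger energy, by Cauchy–Schwarz;
re-insert particle `i` in the `y`-normalised smooth superposition over the `≥ 8N` empty cells of a grid of
`16N` cells of side `ℓ = L/(16N)^{1/3} ≥ 4R` at kinetic cost `≤ C_abs/ℓ²` — no interaction, the cross term
vanishes identically since `∫F² dy ≡ 1`, and the gradient of the cell weights is diluted by the `≥ 8N` empty
cells; symmetrise with `(ε² + Σ_σ (·∘σ)²)^{1/2} − ε`, a `C¹` Bose-symmetric Dirichlet function whose Rayleigh
quotient is at most that of the pieces; with `(π/2r)² > C_abs (16N)^{2/3}/L²`, i.e. `θ₀ = (π/2√C_abs)³/16`, the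
quotient is `< E₀`, contradicting minimality. For `Q = ∅` the hypothesis contradicts `‖Ψ‖ = 1`.)
[cite: LSSY2005, Ch. 2 (2.10)–(2.13); ReedSimonIV1978, §XIII.15] -/
theorem stub_releaseReinsert :
    ∃ θ₀ : ℝ, 0 < θ₀ ∧ ∃ c₃ : ℝ, 0 < c₃ ∧
      ∀ (N : ℕ) (v : ℝ → ℝ≥0∞) (L b R : ℝ) (C : ℝ≥0), 1 ≤ N → 0 < L → 0 < b → b ≤ R → Measurable v →
        (∀ s : ℝ, s ∈ Set.Icc 0 b → v s = ⊤) → (∀ s : ℝ, b < s → v s ≤ C) →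
        (∀ s : ℝ, R < s → v s = 0) → (N : ℝ) * R ^ 3 ≤ c₃ * L ^ 3 →
        ∀ Q : Set (Config N), IsOpen Q →
          Q ⊆ {Z : Config N | Z ∈ boxN N L ∧ ∀ i j : Fin N, i ≠ j → b < dist (Z i) (Z j)} →
          (∀ X ∈ Q, ∀ Y : Config N,
            JoinedIn {Z : Config N | Z ∈ boxN N L ∧ ∀ i j : Fin N, i ≠ j → b < dist (Z i) (Z j)} X Y →
              Y ∈ Q) →
          (∀ (σ : Equiv.Perm (Fin N)) (X : Config N), X ∈ Q → X ∘ σ ∈ Q) →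
          (∀ X ∈ Q, ∃ (i : Fin N) (p : Space) (r : ℝ), (N : ℝ) * r ^ 3 ≤ θ₀ * L ^ 3 ∧ ∀ Y : Config N,
            JoinedIn {Z : Config N | Z ∈ boxN N L ∧ ∀ i j : Fin N, i ≠ j → b < dist (Z i) (Z j)} X Y →
              dist (Y i) p ≤ r) →
          ∀ Ψ : Config N → ℂ, IsGroundState v L Ψ → (∀ᵐ X : Config N, X ∉ Q → Ψ X = 0) → False := by
  sorry

/-- **Stub P5 — OPEN KERNEL (the zoo), verbatim Stub 22 of line `Sketch` (shared): uniqueness at low density for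
walls that are NOT a plain hard core with an essentially bounded tail** (hollow shells, gap bonds, essentially
unbounded finite shoulders, non-integrable finite walls). Not attempted by this line either; recorded so that the
composition reaches the crux by name. [cite: ReedSimonIV1978, Thm XIII.48] -/
theorem stub_uniquenessKernelZoo :
    ∀ v : ℝ → ℝ≥0∞, IsRepulsiveFiniteRange v →
      (¬ ∀ r : ℝ, 0 < r → ∃ C : ℝ≥0, ∀ᵐ s : ℝ, r ≤ s → v s ≤ C) →
      (¬ ∃ b : ℝ, 0 < b ∧ ∃ C : ℝ≥0, (∀ᵐ s : ℝ, s ∈ Set.Icc 0 b → v s = ⊤) ∧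
          (∀ᵐ s : ℝ, b < s → v s ≤ C)) →
      ∃ ρ₀ : ℝ, 0 < ρ₀ ∧ ∀ ρ : ℝ, 0 < ρ → ρ < ρ₀ → ∀ᶠ N : ℕ in atTop,
        ∀ Ψ Φ : Config N → ℂ, IsGroundState v (sideLength ρ N) Ψ →
          IsGroundState v (sideLength ρ N) Φ →
          ∃ c : ℂ, ‖c‖ = 1 ∧ ∀ᵐ X : Config N, Φ X = c * Ψ X := by
  sorry

/-! ## Glue (sorry-free): the principal region as a Perron–Frobenius carrier -/

section Geometry

variable {N : ℕ} {L b : ℝ}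

/-- The free region is invariant under relabelling. [folklore] -/
theorem comp_perm_mem_free (σ : Equiv.Perm (Fin N)) {c : ℝ} {X : Config N}
    (hX : X ∈ {Z : Config N | Z ∈ boxN N L ∧ ∀ i j : Fin N, i ≠ j → c < dist (Z i) (Z j)}) :
    X ∘ σ ∈ {Z : Config N | Z ∈ boxN N L ∧ ∀ i j : Fin N, i ≠ j → c < dist (Z i) (Z j)} := by
  refine ⟨fun i => hX.1 (σ i), fun i j hij => ?_⟩
  exact hX.2 (σ i) (σ j) (fun h => hij (σ.injective h))

/-- Relabelling transports paths in the free region. [folklore] -/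
theorem joinedIn_free_comp_perm (σ : Equiv.Perm (Fin N)) {X Y : Config N}
    (h : JoinedIn {Z : Config N | Z ∈ boxN N L ∧ ∀ i j : Fin N, i ≠ j → b < dist (Z i) (Z j)} X Y) :
    JoinedIn {Z : Config N | Z ∈ boxN N L ∧ ∀ i j : Fin N, i ≠ j → b < dist (Z i) (Z j)}
      (X ∘ σ) (Y ∘ σ) := by
  have hf : Continuous fun Z : Config N => (Z ∘ σ : Config N) :=
    continuous_pi fun i => continuous_apply (σ i)
  refine (h.map hf).mono ?_
  rintro _ ⟨Z, hZ, rfl⟩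
  exact comp_perm_mem_free σ hZ

/-- Undoing a relabelling. [folklore] -/
theorem comp_perm_comp_symm (σ : Equiv.Perm (Fin N)) (X : Config N) :
    ((X ∘ σ) ∘ (σ.symm : Fin N → Fin N) : Config N) = X := by
  funext i
  simp

/-- In an open set of configurations every point is joined to all points of a small ball around it
(balls are convex). [folklore] -/
theorem exists_ball_joinedIn {F : Set (Config N)} (hF : IsOpen F) {X : Config N} (hX : X ∈ F) :
    ∃ ε : ℝ, 0 < ε ∧ ∀ Y : Config N, dist Y X < ε → JoinedIn F X Y := by
  obtain ⟨ε, hε, hball⟩ := Metric.isOpen_iff.1 hF X hX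
  refine ⟨ε, hε, fun Y hY => ?_⟩
  refine JoinedIn.of_segment_subset ((convex_ball X ε).segment_subset (mem_ball_self hε) ?_ |>.trans hball)
  exact hY

end Geometry

/-- **Uniqueness for the ESSENTIAL hard-core class at low density, eventually — by pinning exclusion**
(Stubs P1–P4 with the landed Stubs 0, 5a, 5b, 6, 14–20 of line `Sketch`): if `v = ⊤` a.e. on `[0,b]` and
`v ≤ C` a.e. beyond `b` (`b > 0`), then for `ρ` below `min (ρ₁(v), c₁/b³, c₂/b³, c₃/R³)` (`R = max b R₀`) and all large `N`
the closed-form ground state in the box of side `(N/ρ)^{1/3}` is unique up to phase (`θ₀, c₃` from Stub P4 feed Stub P2). [folklore] -/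
theorem uniqueHardCorePin (v : ℝ → ℝ≥0∞) (hv : IsRepulsiveFiniteRange v)
    (hHC : ∃ b : ℝ, 0 < b ∧ ∃ C : ℝ≥0, (∀ᵐ s : ℝ, s ∈ Set.Icc 0 b → v s = ⊤) ∧
      (∀ᵐ s : ℝ, b < s → v s ≤ C)) :
    ∃ ρ₀ : ℝ, 0 < ρ₀ ∧ ∀ ρ : ℝ, 0 < ρ → ρ < ρ₀ → ∀ᶠ N : ℕ in atTop,
      HasUniqueGroundState v N (sideLength ρ N) := by
  obtain ⟨b, hb, C, hcoreae, htailae⟩ := hHC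
  obtain ⟨κ, hκ, c₁, hc₁, hpark⟩ := stub_parking
  obtain ⟨θ₀, hθ₀, c₃, hc₃, hrel⟩ := stub_releaseReinsert
  obtain ⟨c₂, hc₂, hpin⟩ := stub_pinnedOrParked κ hκ θ₀ hθ₀
  obtain ⟨R₀, hR₀, hvR₀⟩ := hv.exists_pos_range
  obtain ⟨ρ₁, hρ₁, h₁⟩ := stub_finiteEnergyLowDensity v hv
  classical
  -- a pointwise representative off a null set of radii
  set v' : ℝ → ℝ≥0∞ := fun s => if s ∈ Set.Icc 0 b then ⊤ else (if b < s then min (v s) C else v s)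
    with hv'def
  set Sbad : Set ℝ := {s | s ∈ Set.Icc 0 b ∧ v s ≠ ⊤} ∪ {s | b < s ∧ (C : ℝ≥0∞) < v s} with hSbad
  have hSm : MeasurableSet Sbad := by
    refine MeasurableSet.union ?_ ?_
    · exact measurableSet_Icc.inter (hv.1 (measurableSet_singleton ⊤)).compl
    · exact (measurableSet_lt measurable_const measurable_id).inter
        (measurableSet_lt measurable_const hv.1)
  have hS0 : volume Sbad = 0 := by
    rw [hSbad, measure_union_null_iff]
    constructor
    · rw [measure_eq_zero_iff_ae_notMem]
      filter_upwards [hcoreae] with s hs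
      simp only [not_and, not_not]
      exact hs
    · rw [measure_eq_zero_iff_ae_notMem]
      filter_upwards [htailae] with s hs
      simp only [not_and, not_lt]
      exact hs
  have hvv' : ∀ r, r ∉ Sbad → v r = v' r := by
    intro r hr
    simp only [hSbad, Set.mem_union, Set.mem_setOf_eq, not_or, not_and, not_not, not_lt] at hr
    by_cases h1 : r ∈ Set.Icc 0 b
    · simp only [hv'def]; rw [if_pos h1]; exact hr.1 h1
    · by_cases h2 : b < r
      · simp only [hv'def]; rw [if_neg h1, if_pos h2]; exact (min_eq_left (hr.2 h2)).symm
      · simp only [hv'def]; rw [if_neg h1, if_neg h2]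
  have hv'm : Measurable v' := by
    refine Measurable.ite measurableSet_Icc measurable_const ?_
    exact Measurable.ite (measurableSet_lt measurable_const measurable_id)
      (hv.1.min measurable_const) hv.1
  have hcore' : ∀ s : ℝ, s ∈ Set.Icc 0 b → v' s = ⊤ := fun s hs => by
    simp only [hv'def]; rw [if_pos hs]
  have htail' : ∀ s : ℝ, b < s → v' s ≤ C := by
    intro s hs
    have hs' : s ∉ Set.Icc 0 b := fun h => not_lt.2 h.2 hs
    simp only [hv'def]; rw [if_neg hs', if_pos hs]; exact min_le_right _ _
  -- a range `R ≥ b` of the representative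
  set R : ℝ := max b R₀ with hRdef
  have hbR : b ≤ R := le_max_left _ _
  have hRpos : 0 < R := hb.trans_le hbR
  have hrange' : ∀ s : ℝ, R < s → v' s = 0 := by
    intro s hs
    have hbs : b < s := hbR.trans_lt hs
    have hs' : s ∉ Set.Icc 0 b := fun h => not_lt.2 h.2 hbs
    have h0 : v s = 0 := hvR₀ s ((le_max_right _ _).trans_lt hs)
    simp only [hv'def]; rw [if_neg hs', if_pos hbs, h0]; simp
  -- the density threshold
  refine ⟨min ρ₁ (min (c₁ / b ^ 3) (min (c₂ / b ^ 3) (c₃ / R ^ 3))),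
    lt_min hρ₁ (lt_min (by positivity) (lt_min (by positivity) (by positivity))), fun ρ hρ hρm => ?_⟩
  have hρ₁' : ρ < ρ₁ := hρm.trans_le (min_le_left _ _)
  have hρc₁ : ρ < c₁ / b ^ 3 := hρm.trans_le ((min_le_right _ _).trans (min_le_left _ _))
  have hρc₂ : ρ < c₂ / b ^ 3 :=
    hρm.trans_le ((min_le_right _ _).trans ((min_le_right _ _).trans (min_le_left _ _)))
  have hρc₃ : ρ < c₃ / R ^ 3 :=
    hρm.trans_le ((min_le_right _ _).trans ((min_le_right _ _).trans (min_le_right _ _)))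
  filter_upwards [h₁ ρ hρ hρ₁', eventually_ge_atTop 1] with N hE hN
  -- bookkeeping: `N a³ ≤ c L³` is `ρ a³ ≤ c`
  have hdens : ∀ {a c : ℝ}, 0 < a → ρ < c / a ^ 3 → (N : ℝ) * a ^ 3 ≤ c * sideLength ρ N ^ 3 := by
    intro a c ha hρc
    rw [Negative.sideLength_pow_three hρ (by omega)]
    have ha3 : 0 < a ^ 3 := by positivity
    have h1 : ρ * a ^ 3 ≤ c := by
      rw [lt_div_iff₀ ha3] at hρc
      exact hρc.le
    have hNn : (0 : ℝ) ≤ N := by positivity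
    calc (N : ℝ) * a ^ 3 = (N / ρ) * (ρ * a ^ 3) := by field_simp
      _ ≤ (N / ρ) * c := by gcongr
      _ = c * (N / ρ) := by ring
  set L := sideLength ρ N with hLdef
  have hL : 0 < L := sideLength_pos_of_pos hρ (by omega)
  have hE' : groundStateEnergy v' N L ≠ ⊤ := by
    rwa [← groundStateEnergy_congr_offNull hSm hS0 hvv' N L]
  have hNb₁ : (N : ℝ) * b ^ 3 ≤ c₁ * L ^ 3 := hdens hb hρc₁
  have hNb₂ : (N : ℝ) * b ^ 3 ≤ c₂ * L ^ 3 := hdens hb hρc₂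
  have hNR : (N : ℝ) * R ^ 3 ≤ c₃ * L ^ 3 := hdens hRpos hρc₃
  -- the free region, the well-separated set, the principal region and its complement
  set F : Set (Config N) := {Z : Config N | Z ∈ boxN N L ∧ ∀ i j : Fin N, i ≠ j → b < dist (Z i) (Z j)}
    with hFdef
  set W : Set (Config N) :=
    {Z : Config N | Z ∈ boxN N L ∧ ∀ i j : Fin N, i ≠ j → κ * b < dist (Z i) (Z j)} with hWdef
  set P : Set (Config N) := {X : Config N | X ∈ F ∧ ∃ Wt ∈ W, JoinedIn F X Wt} with hPdef
  set Q : Set (Config N) := {X : Config N | X ∈ F ∧ ¬ ∃ Wt ∈ W, JoinedIn F X Wt} with hQdef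
  have hFopen : IsOpen F := HardCoreOfConnected.isOpen_free N L b
  have hWF : W ⊆ F := by
    intro Z hZ
    refine ⟨hZ.1, fun i j hij => lt_of_le_of_lt ?_ (hZ.2 i j hij)⟩
    have : (1 : ℝ) * b ≤ κ * b := by gcongr
    simpa using this
  obtain ⟨-, hparkNL⟩ := hpark N L b hL hb hNb₁
  have hPsub : P ⊆ F := fun X hX => hX.1
  have hQsub : Q ⊆ F := fun X hX => hX.1
  -- openness of `P` and `Q`
  have hPopen : IsOpen P := by
    refine Metric.isOpen_iff.2 fun X hX => ?_
    obtain ⟨ε, hε, hεJ⟩ := exists_ball_joinedIn hFopen hX.1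
    refine ⟨ε, hε, fun Y hY => ?_⟩
    have hXY : JoinedIn F X Y := hεJ Y hY
    obtain ⟨Wt, hWt, hXWt⟩ := hX.2
    exact ⟨hXY.target_mem, Wt, hWt, hXY.symm.trans hXWt⟩
  have hQopen : IsOpen Q := by
    refine Metric.isOpen_iff.2 fun X hX => ?_
    obtain ⟨ε, hε, hεJ⟩ := exists_ball_joinedIn hFopen hX.1
    refine ⟨ε, hε, fun Y hY => ?_⟩
    have hXY : JoinedIn F X Y := hεJ Y hY
    refine ⟨hXY.target_mem, ?_⟩
    rintro ⟨Wt, hWt, hYWt⟩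
    exact hX.2 ⟨Wt, hWt, hXY.trans hYWt⟩
  have hPmeas : MeasurableSet P := hPopen.measurableSet
  -- `Q` is closed under paths, relabelling-invariant and pinned
  have hQcl : ∀ X ∈ Q, ∀ Y : Config N, JoinedIn F X Y → Y ∈ Q := by
    intro X hX Y hXY
    refine ⟨hXY.target_mem, ?_⟩
    rintro ⟨Wt, hWt, hYWt⟩
    exact hX.2 ⟨Wt, hWt, hXY.trans hYWt⟩
  have hQsymm : ∀ (σ : Equiv.Perm (Fin N)) (X : Config N), X ∈ Q → X ∘ σ ∈ Q := by
    intro σ X hX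
    refine ⟨comp_perm_mem_free σ hX.1, ?_⟩
    rintro ⟨Wt, hWt, hJ⟩
    have hJ' := joinedIn_free_comp_perm (b := b) σ.symm hJ
    rw [comp_perm_comp_symm] at hJ'
    exact hX.2 ⟨Wt ∘ (σ.symm : Fin N → Fin N), comp_perm_mem_free σ.symm hWt, hJ'⟩
  have hQpin : ∀ X ∈ Q, ∃ (i : Fin N) (p : Space) (r : ℝ), (N : ℝ) * r ^ 3 ≤ θ₀ * L ^ 3 ∧
      ∀ Y : Config N, JoinedIn F X Y → dist (Y i) p ≤ r := by
    intro X hX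
    rcases hpin N L b hL hb hNb₂ X hX.1 with ⟨Wt, hWt, hJ⟩ | hpinned
    · exact absurd ⟨Wt, hWt, hJ⟩ hX.2
    · exact hpinned
  -- no ground state charges `Q`; every ground state vanishes a.e. off `P`
  have hvanQ : ∀ Ψ : Config N → ℂ, IsGroundState v' L Ψ → ∀ᵐ X : Config N, X ∈ Q → Ψ X = 0 := by
    intro Ψ hΨ
    by_contra hne
    obtain ⟨Φ, hΦ, hΦQ⟩ :=
      stub_restrictToInvariantPiece N v' L b hL hb hv'm hcore' Q hQopen hQsub hQcl hQsymm Ψ hΨ hne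
    exact hrel N v' L b R C hN hL hb hbR hv'm hcore' htail' hrange' hNR Q hQopen hQsub hQcl hQsymm
      hQpin Φ hΦ hΦQ
  have hvanP : ∀ Ψ : Config N → ℂ, IsGroundState v' L Ψ → ∀ᵐ X : Config N, X ∉ P → Ψ X = 0 := by
    intro Ψ hΨ
    filter_upwards [stub_vanishOffFree N v' L b hb hcore' Ψ hΨ, hvanQ Ψ hΨ] with X hXF hXQ hXP
    by_cases hmem : X ∈ F
    · exact hXQ ⟨hmem, fun h => hXP ⟨hmem, h⟩⟩
    · exact hXF hmem
  -- `P` is a single path class (parking), hence chain-connected with clearance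
  have hchain : ∀ X ∈ P, ∀ Y ∈ P, ∃ (k : ℕ) (Z : ℕ → Config N) (m : ℝ), Z 0 = X ∧ Z k = Y ∧ 0 < m ∧
      (∀ l : ℕ, l ≤ k → Z l ∈ boxN N L) ∧
      ∀ l : ℕ, l < k → ∀ θ : ℝ, θ ∈ Set.Icc (0 : ℝ) 1 → ∀ i j : Fin N, i ≠ j →
        b + 2 * m ≤ ‖(1 - θ) • (Z l i - Z l j) + θ • (Z (l + 1) i - Z (l + 1) j)‖ := by
    intro X hX Y hY
    obtain ⟨W₁, hW₁, hXW₁⟩ := hX.2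
    obtain ⟨W₂, hW₂, hYW₂⟩ := hY.2
    have hXY : JoinedIn F X Y := (hXW₁.trans (hparkNL W₁ hW₁ W₂ hW₂)).trans hYW₂.symm
    exact stub_polygonalChain N L b X Y hXY
  -- component-wise Perron–Frobenius on the carrier `P` (landed Stub 19) and the lattice argument (Stub 20)
  have hU : HasUniqueGroundState v' N L := by
    refine stub_uniqueOfPosOn stub_lincombGroundState N v' L P hPmeas
      (stub_existsNonnegGroundState stub_compactness N v' L hE') hvanP ?_
    intro Ψ₀ hΨ₀ hGS
    exact stub_posOfConnected (stub_chainedTube stub_localTubeCore) N v' L b C hN hL hb hv'm hcore' htail'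
      (groundStateEnergy_trunc_iSup_hardCore N v' L b C hN hL hb hv'm hcore' htail') P hPmeas hPsub hchain
      hvanP Ψ₀ hΨ₀ hGS
  exact (hasUniqueGroundState_iff_offNull hSm hS0 hvv').2 hU

/-- **Uniqueness for admissible potentials with a wall at a positive radius, at low density** (class
(b/c)): the essential hard-core class by `uniqueHardCorePin` (Stubs P1–P4), everything else by the zoo kernel
(Stub P5, with the landed Stubs 0, 5a, 5b). [folklore] -/
theorem uniqueWall (v : ℝ → ℝ≥0∞) (hv : IsRepulsiveFiniteRange v)
    (hb : ¬ ∀ r : ℝ, 0 < r → ∃ C : ℝ≥0, ∀ᵐ s : ℝ, r ≤ s → v s ≤ C) :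
    ∃ ρ₀ : ℝ, 0 < ρ₀ ∧ ∀ ρ : ℝ, 0 < ρ → ρ < ρ₀ → ∀ᶠ N : ℕ in atTop,
      HasUniqueGroundState v N (sideLength ρ N) := by
  by_cases hHC : ∃ b : ℝ, 0 < b ∧ ∃ C : ℝ≥0, (∀ᵐ s : ℝ, s ∈ Set.Icc 0 b → v s = ⊤) ∧
      (∀ᵐ s : ℝ, b < s → v s ≤ C)
  · exact uniqueHardCorePin v hv hHC
  · obtain ⟨ρ₁, hρ₁, h₁⟩ := stub_finiteEnergyLowDensity v hv
    obtain ⟨ρ₂, hρ₂, h₂⟩ := stub_uniquenessKernelZoo v hv hb hHC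
    refine ⟨min ρ₁ ρ₂, lt_min hρ₁ hρ₂, fun ρ hρ hρm => ?_⟩
    filter_upwards [h₁ ρ hρ (hρm.trans_le (min_le_left _ _)),
      h₂ ρ hρ (hρm.trans_le (min_le_right _ _))] with N hE hU
    exact ⟨stub_existsNonnegGroundState stub_compactness N v (sideLength ρ N) hE, hU⟩

/-- **Eventual uniqueness** for every admissible `v`: class (a) (essentially locally bounded on `(0,∞)`,
including bounded `v` and soft cores) by the landed `hasUniqueGroundState_of_essLocBdd` with `E₀ < ⊤` eventually
(Stub 5a); walls at a positive radius by `uniqueWall`. [folklore] -/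
theorem eventualUniqueness (v : ℝ → ℝ≥0∞) (hv : IsRepulsiveFiniteRange v) :
    ∃ ρ₀ : ℝ, 0 < ρ₀ ∧ ∀ ρ : ℝ, 0 < ρ → ρ < ρ₀ → ∀ᶠ N : ℕ in atTop,
      HasUniqueGroundState v N (sideLength ρ N) := by
  by_cases hlb : ∀ r : ℝ, 0 < r → ∃ C : ℝ≥0, ∀ᵐ s : ℝ, r ≤ s → v s ≤ C
  · obtain ⟨ρ₁, hρ₁, h₁⟩ := stub_finiteEnergyLowDensity v hv
    refine ⟨ρ₁, hρ₁, fun ρ hρ hρ₁' => ?_⟩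
    filter_upwards [h₁ ρ hρ hρ₁', eventually_ge_atTop 1] with N hE hN
    exact hasUniqueGroundState_of_essLocBdd N v (sideLength ρ N) hN (sideLength_pos_of_pos hρ (by omega))
      hv.1 hlb hE
  · exact uniqueWall v hv hlb

/-! ## Composition (sorry-free): the stubs give the crux BY NAME -/

/-- **`GroundStateRigidity` from the five registered stubs** (kernel-checked glue, no `sorry` of its own):
eventual uniqueness (above) and rigidity-from-uniqueness (landed Stub 1 fed with landed Stub 0).
[cite: ReedSimonIV1978, §XIII.12] -/
theorem GroundStateRigidity_of : GroundStateRigidity := by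
  intro v hv
  obtain ⟨ρ₀, hρ₀, hU⟩ := eventualUniqueness v hv
  refine ⟨ρ₀, hρ₀, fun ρ hρ hρ₀' => ?_⟩
  filter_upwards [hU ρ hρ hρ₀'] with N hN
  intro η hη
  exact stub_rigidityOfUnique stub_compactness v N (sideLength ρ N) hN η hη

/-- The same composition read against the verbatim-shared decl of route `BECClassicalWindow` (the registered
skeleton's `crux_decl`; the two `def`s are syntactically identical). [cite: ReedSimonIV1978, §XIII.12] -/
theorem GroundStateRigidity_proof :
    Summit.AtomisticToContinuum.BoseEinsteinCondensation.Theses.BECClassicalWindow.GroundStateRigidity :=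
  GroundStateRigidity_of

end Summit.AtomisticToContinuum.BoseEinsteinCondensation.Cruxes.GroundStateRigidity.PinningExclusion

end
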